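import Literature.Analysis.Fourier.FejerDyadicDecomposition
import Mathlib.Algebra.Ring.GeomSum
import HarnessLib

/-!
# Dyadic Fejér telescoping with higher powers: smoother multiscale pieces

The dyadic Fejér decomposition of `1/sin²(πx)` (`FejerDyadicDecomposition.lean`) telescopes the ratios
`ρ_N := F_{2^N−1}/2^N`; its pieces `F_{2^N−1}² = 4^N ρ_N²` decay like `x⁻⁴` off the shell `x ∼ 2^{−N}`.
Telescoping the `m`-th POWERS `ρ_N^m` instead gives, for every `m ≥ 1`, the exact identity

  `sin²(πx) · Σ_{N<J} W^{(m)}_N(x) + ρ_J(x)^m = 1`,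
  `W^{(m)}_N := 4^N · ρ_N^{m+1} · Σ_{i<m} c_N^i`,  `c_N := cos²(π 2^N x)`      (`fejer_dyadic_telescope_pow`)

(`ρ_{N+1} = c_N ρ_N`, `sin²(πx)·4^Nρ_N = sin²(π2^Nx) = 1 − c_N`, `1 − c^m = (1 − c)Σ_{i<m}c^i`), with
nonnegative pieces `W^{(m)}_N ≤ m·4^N` that are trigonometric polynomials of degree `< m·2^N` in `x`
and decay like `x^{−2(m+1)}`: `W^{(m)}_N ≤ m·4^N/(4·4^N x²)^{m+1}` (`fejer_dyadic_piece_pow_le_inv`).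
For `m = 1` this is `fejer_dyadic_telescope`; for larger `m` the pieces of the resulting finite-range
decomposition have `2m` well-scaled lattice derivatives (the `d = 3` shell sum `Σ_j 2^{j(1−2m+|α|)}`
converges for `|α| ≤ 2m − 2`), at the price of range `< m·2^{N+1}·range(A)`.  As polynomials in
`X = cos 2πx`: `W^{(m)}_N = 4^N (P_{2^N−1}/2^N)^{m+1} Σ_{i<m} ((1 + T_{2^N})/2)^i`
(`fejerPoly_dyadic_identity_pow`), a sum of products of squares (and of the factor `(1+X)/2` when
`N = 0`), hence positive semidefinite when evaluated at a symmetric `B = 1 − A/2` with `A ≤ 4`.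
Statements are [folklore]-grade consequences of `fejer_mul_sin_sq`; the construction follows
[cite: Bauerschmidt2013, Thm. 1.2 (smoothness of finite-range pieces)] in spirit only.
-/

noncomputable section

open Real Finset Polynomial

namespace Literature.Analysis.Fourier.TrigApprox

/-- `sin²(πx) · 4^N ρ_N(x) = 1 − cos²(π 2^N x)`. [folklore] -/
theorem sin_sq_mul_four_pow_mul_ratio (N : ℕ) (x : ℝ) :
    Real.sin (π * x) ^ 2 * (4 ^ N * (fejer (2 ^ N - 1) x / 2 ^ N))
      = 1 - Real.cos (π * (2 ^ N * x)) ^ 2 := by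
  have h := fejer_mul_sin_sq (2 ^ N - 1) x
  have hc : ((2 ^ N - 1 : ℕ) : ℝ) + 1 = 2 ^ N := by
    rw [Nat.cast_sub Nat.one_le_two_pow]; push_cast; ring
  rw [hc, show π * 2 ^ N * x = π * (2 ^ N * x) by ring] at h
  have h4 : (4 : ℝ) ^ N = 2 ^ N * 2 ^ N := by
    rw [← mul_pow]; norm_num
  rw [Real.cos_sq', h4, sub_sub_cancel]
  have h2 : (2 : ℝ) ^ N ≠ 0 := by positivity
  have : (2 : ℝ) ^ N * 2 ^ N * (fejer (2 ^ N - 1) x / 2 ^ N) = fejer (2 ^ N - 1) x * 2 ^ N := by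
    field_simp
  rw [this]
  linear_combination h

/-- **Dyadic Fejér telescoping with the `m`-th power.**  For all real `x` and all `m J : ℕ`:
`sin²(πx) · Σ_{N<J} 4^N ρ_N^{m+1} Σ_{i<m} c_N^i + ρ_J^m = 1`, where `ρ_N = F_{2^N−1}(x)/2^N` and
`c_N = cos²(π2^N x)`. [folklore] -/
theorem fejer_dyadic_telescope_pow (m J : ℕ) (x : ℝ) :
    Real.sin (π * x) ^ 2 * ∑ N ∈ Finset.range J,
        4 ^ N * (fejer (2 ^ N - 1) x / 2 ^ N) ^ (m + 1)
          * ∑ i ∈ Finset.range m, (Real.cos (π * (2 ^ N * x)) ^ 2) ^ i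
      + (fejer (2 ^ J - 1) x / 2 ^ J) ^ m = 1 := by
  induction J with
  | zero => simp [fejer, dirSum, e_zero]
  | succ J ih =>
    rw [Finset.sum_range_succ, mul_add, fejer_two_pow_succ_div, mul_pow]
    set ρ := fejer (2 ^ J - 1) x / 2 ^ J with hρ
    set c := Real.cos (π * (2 ^ J * x)) ^ 2 with hc
    have hstep : Real.sin (π * x) ^ 2 * (4 ^ J * ρ ^ (m + 1) * ∑ i ∈ Finset.range m, c ^ i)
        = ρ ^ m - c ^ m * ρ ^ m := by
      have h1 : Real.sin (π * x) ^ 2 * (4 ^ J * ρ) = 1 - c := sin_sq_mul_four_pow_mul_ratio J x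
      have hg : (∑ i ∈ Finset.range m, c ^ i) * (c - 1) = c ^ m - 1 := geom_sum_mul c m
      calc Real.sin (π * x) ^ 2 * (4 ^ J * ρ ^ (m + 1) * ∑ i ∈ Finset.range m, c ^ i)
          = (Real.sin (π * x) ^ 2 * (4 ^ J * ρ)) * ρ ^ m * ∑ i ∈ Finset.range m, c ^ i := by ring
        _ = (1 - c) * ρ ^ m * ∑ i ∈ Finset.range m, c ^ i := by rw [h1]
        _ = ρ ^ m - c ^ m * ρ ^ m := by linear_combination (-ρ ^ m) * hg
    linear_combination ih + hstep

/-- The pieces are nonnegative. [folklore] -/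
theorem fejer_dyadic_piece_pow_nonneg (m N : ℕ) (x : ℝ) :
    0 ≤ 4 ^ N * (fejer (2 ^ N - 1) x / 2 ^ N) ^ (m + 1)
      * ∑ i ∈ Finset.range m, (Real.cos (π * (2 ^ N * x)) ^ 2) ^ i := by
  have h0 := fejer_two_pow_div_nonneg N x
  have : 0 ≤ ∑ i ∈ Finset.range m, (Real.cos (π * (2 ^ N * x)) ^ 2) ^ i :=
    Finset.sum_nonneg fun i _ => by positivity
  positivity

/-- `Σ_{i<m} c^i ≤ m` for `0 ≤ c ≤ 1`. [folklore] -/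
theorem sum_pow_le_of_le_one {c : ℝ} (hc0 : 0 ≤ c) (hc1 : c ≤ 1) (m : ℕ) :
    ∑ i ∈ Finset.range m, c ^ i ≤ m := by
  calc ∑ i ∈ Finset.range m, c ^ i ≤ ∑ _i ∈ Finset.range m, (1 : ℝ) :=
        Finset.sum_le_sum fun i _ => pow_le_one₀ hc0 hc1
    _ = m := by simp

/-- **Ultraviolet bound**: `W^{(m)}_N ≤ m · 4^N`. [folklore] -/
theorem fejer_dyadic_piece_pow_le (m N : ℕ) (x : ℝ) :
    4 ^ N * (fejer (2 ^ N - 1) x / 2 ^ N) ^ (m + 1)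
      * ∑ i ∈ Finset.range m, (Real.cos (π * (2 ^ N * x)) ^ 2) ^ i ≤ m * 4 ^ N := by
  have h0 := fejer_two_pow_div_nonneg N x
  have h1 := fejer_two_pow_div_le_one N x
  have hρ : (fejer (2 ^ N - 1) x / 2 ^ N) ^ (m + 1) ≤ 1 := pow_le_one₀ h0 h1
  have hc : ∑ i ∈ Finset.range m, (Real.cos (π * (2 ^ N * x)) ^ 2) ^ i ≤ m :=
    sum_pow_le_of_le_one (sq_nonneg _) (by nlinarith [Real.cos_sq_le_one (π * (2 ^ N * x))]) m
  have hc0 : 0 ≤ ∑ i ∈ Finset.range m, (Real.cos (π * (2 ^ N * x)) ^ 2) ^ i :=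
    Finset.sum_nonneg fun i _ => by positivity
  calc 4 ^ N * (fejer (2 ^ N - 1) x / 2 ^ N) ^ (m + 1)
        * ∑ i ∈ Finset.range m, (Real.cos (π * (2 ^ N * x)) ^ 2) ^ i
      ≤ 4 ^ N * 1 * m := by gcongr
    _ = m * 4 ^ N := by ring

/-- **Infrared bound**: `W^{(m)}_N ≤ m · 4^N / (4·4^N x²)^{m+1}` for `0 < |x| ≤ 1/2` — decay of order
`x^{−2(m+1)}` off the shell `x ∼ 2^{−N}`. [folklore] -/
theorem fejer_dyadic_piece_pow_le_inv (m N : ℕ) {x : ℝ} (hx0 : x ≠ 0) (hx : |x| ≤ 1 / 2) :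
    4 ^ N * (fejer (2 ^ N - 1) x / 2 ^ N) ^ (m + 1)
      * ∑ i ∈ Finset.range m, (Real.cos (π * (2 ^ N * x)) ^ 2) ^ i
      ≤ m * 4 ^ N / (4 * 4 ^ N * x ^ 2) ^ (m + 1) := by
  have h0 := fejer_two_pow_div_nonneg N x
  have h1 := fejer_two_pow_div_le_inv N hx0 hx
  have hρ : (fejer (2 ^ N - 1) x / 2 ^ N) ^ (m + 1) ≤ (1 / (4 * 4 ^ N * x ^ 2)) ^ (m + 1) :=
    pow_le_pow_left₀ h0 h1 _
  have hc : ∑ i ∈ Finset.range m, (Real.cos (π * (2 ^ N * x)) ^ 2) ^ i ≤ m :=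
    sum_pow_le_of_le_one (sq_nonneg _) (by nlinarith [Real.cos_sq_le_one (π * (2 ^ N * x))]) m
  have hc0 : 0 ≤ ∑ i ∈ Finset.range m, (Real.cos (π * (2 ^ N * x)) ^ 2) ^ i :=
    Finset.sum_nonneg fun i _ => by positivity
  have hx2 : 0 < 4 * 4 ^ N * x ^ 2 := by positivity
  calc 4 ^ N * (fejer (2 ^ N - 1) x / 2 ^ N) ^ (m + 1)
        * ∑ i ∈ Finset.range m, (Real.cos (π * (2 ^ N * x)) ^ 2) ^ i
      ≤ 4 ^ N * (1 / (4 * 4 ^ N * x ^ 2)) ^ (m + 1) * m := by gcongr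
    _ = m * 4 ^ N / (4 * 4 ^ N * x ^ 2) ^ (m + 1) := by
        rw [one_div_pow]
        field_simp

/-- The remainder `ρ_J^m ∈ [0, 1]`. [folklore] -/
theorem fejer_two_pow_div_pow_mem (m J : ℕ) (x : ℝ) :
    (fejer (2 ^ J - 1) x / 2 ^ J) ^ m ∈ Set.Icc (0 : ℝ) 1 :=
  ⟨pow_nonneg (fejer_two_pow_div_nonneg J x) m,
    pow_le_one₀ (fejer_two_pow_div_nonneg J x) (fejer_two_pow_div_le_one J x)⟩

/-! ## Polynomial form -/

/-- `T_{2^N}(cos 2πx) = 2cos²(π2^N x) − 1`. [folklore] -/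
theorem eval_T_two_pow_cos (N : ℕ) (x : ℝ) :
    (Polynomial.Chebyshev.T ℝ (2 ^ N)).eval (Real.cos (2 * π * x))
      = 2 * Real.cos (π * (2 ^ N * x)) ^ 2 - 1 := by
  rw [Polynomial.Chebyshev.T_real_cos,
    show (((2 : ℤ) ^ N : ℤ) : ℝ) * (2 * π * x) = 2 * (π * (2 ^ N * x)) by push_cast; ring,
    Real.cos_sq]
  ring

/-- `½(1 + (2y − 1)) = y`. [folklore] -/
theorem half_mul_one_add_two_mul_sub_one (y : ℝ) : 1 / 2 * (1 + (2 * y - 1)) = y := by ring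

/-- **The `m`-power telescoping as a polynomial identity** in `X = cos 2πx`:
`(1−X)/2 · Σ_{N<J} 4^N (P_{2^N−1}/2^N)^{m+1} Σ_{i<m} ((1+T_{2^N})/2)^i + (P_{2^J−1}/2^J)^m = 1`. [folklore] -/
theorem fejerPoly_dyadic_identity_pow (m J : ℕ) :
    Polynomial.C (1 / 2 : ℝ) * (1 - X) * ∑ N ∈ Finset.range J,
        Polynomial.C ((4 : ℝ) ^ N) * (Polynomial.C (1 / 2 ^ N : ℝ) * fejerPoly (2 ^ N - 1)) ^ (m + 1)
          * ∑ i ∈ Finset.range m,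
            (Polynomial.C (1 / 2 : ℝ) * (1 + Polynomial.Chebyshev.T ℝ (2 ^ N))) ^ i
      + (Polynomial.C (1 / 2 ^ J : ℝ) * fejerPoly (2 ^ J - 1)) ^ m = 1 := by
  apply Polynomial.eq_of_infinite_eval_eq
  refine Set.Infinite.mono (fun y hy => ?_) (Set.Icc_infinite (show (-1 : ℝ) < 1 by norm_num))
  obtain ⟨x, rfl⟩ : ∃ x : ℝ, Real.cos (2 * π * x) = y :=
    ⟨Real.arccos y / (2 * π), by
      rw [mul_div_cancel₀ _ (by positivity : (2 * π : ℝ) ≠ 0)]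
      exact Real.cos_arccos hy.1 hy.2⟩
  simp only [Set.mem_setOf_eq, eval_add, eval_mul, eval_C, eval_sub, eval_one, eval_X, eval_finsetSum,
    eval_pow, fejerPoly_eval_cos, eval_T_two_pow_cos, half_mul_one_add_two_mul_sub_one]
  have h := fejer_dyadic_telescope_pow m J x
  have hs : Real.sin (π * x) ^ 2 = 1 / 2 * (1 - Real.cos (2 * π * x)) := by
    have h2 : Real.cos (π * x) ^ 2 = 1 / 2 + Real.cos (2 * π * x) / 2 := by
      rw [show 2 * π * x = 2 * (π * x) by ring]; exact Real.cos_sq _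
    rw [Real.sin_sq, h2]; ring
  rw [hs] at h
  have hdiv : ∀ N : ℕ, 1 / (2 : ℝ) ^ N * fejer (2 ^ N - 1) x = fejer (2 ^ N - 1) x / 2 ^ N :=
    fun N => by ring
  simp only [hdiv]
  linear_combination h

end Literature.Analysis.Fourier.TrigApprox

end
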